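import Literature.NumberTheory.Automorphic.WhittakerTwistedJacquet                          -- ★ `Representation.charTwist`, `coinvariantsMk_charTwist_apply`, `IsSmooth.twist` (via import), BZ `coinvariantsMap_injective_of_isLimitOfCompactOpen`
import Summits.HodgeConjecture.HodgeConjecture.Theorems.F0P3bU2PrincipalSeriesJacquetRankLeTwo   -- ★ (Supp)₂ `hasCompactSupport_cellFun_cmBorel_two`; brings ★ `SmoothIndOpenCellCoinvariants` (cell map, `I_open`), ★ `CompactlySupportedCoinvariants` (G1), ★ `u2LocalBruhatDecomposition`, ★ `isLimitOfCompactOpen_cmBorelTriple_N`, ★ `rootDeltaChar_eq_one_of_isLimitOfCompactOpen`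
import HarnessLib

/-!
# R90-TF · S4 «Ch. 13.1–2» — (SWAP) road, brick (a): the `θ`-TWISTED coinvariants of the principal series of `U(Φ₂)(L⁺_v) ≅ U(1,1)`
# are at most ONE-dimensional, `dim i(χ)_{N,θ} ≤ 1` for every non-trivial smooth character `θ` of `N(L⁺_v)`

Cell `hodgecm-mathlib`, crux H413 (`stmt-HodgeConjecture-24833`, lane `--supports … --as helper`), route of record `HCCMUnconditional`
(count-neutral).  Programme R90-TF, section S4 = Rogawski Ch. 13.1–2 (base `R90-C131`, dealer K2E2-plan (g6)); seat K2E3-p11 (g9), taking BY NAME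
the open hand «(a) `dim i(χ)_{N,ψ} ≤ 1`» of R90-C131-p01 (g0)'s Whittaker-model road to (SWAP) = B ED. 4 `stub_R90_S4_U2_ldsSwap` (census
`R90/R90-C131-p01/g0/CENSUS-orbit.md` 62930f5ed58633f2, step (a)).  THEOREMS ONLY (no `def` ∕ instance ∕ notation ∕ named fact ∕ `sorry`); ★-only
imports; never imports `Cruxes/…/Lines`.

THE POINT.  The slot lemma ★ `R90S4TwistedCoinvariantSlot.not_nontrivial_coinvariants_charTwist_of_ne` (p01) asks for
`[Module.Finite ℂ (ρ.charTwist H θ).Coinvariants]` and `finrank ≤ 1`.  §4 `finrank_coinvariants_charTwist_cmPrincipalSeries_two_le_one` supplies both at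
`ρ = i(χ) = cmPrincipalSeries L 2 v χ`, `H = N` the unipotent radical of the CM Borel `cmBorelTriple L 2 v`, for EVERY `χ`, EVERY non-trivial
`θ : N →* ℂˣ` with open kernel, at a NON-SPLIT `v` — the `θ`-twisted twin of ★ `F0P3bU2PrincipalSeriesJacquetRankLeTwo` (`dim r_B i(χ) ≤ 2`): the closed
Bruhat cell carries NO twisted coinvariants, so the bound drops to `dim W = 1` [Casselman1995, §6.3, Lemma 7.1.1 (a); BernsteinZelevinskyASENS1977, Thm. 5.2;
Bump1997, §4.4 pp. 460–465].  ROAD: §1 TWISTED G1 — `dim (C_c^∞(N, W) ⊗ η)_N ≤ dim W` for `η` with open kernel (in the twisted coinvariants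
`[g · φ] = η(g)⁻¹ [φ]`, so ★ `indicatorSection_eq_sum_transversal` gives `[1_U ⊗ w] = (Σ_{r ∈ R} η(r)⁻¹) • [1_V ⊗ w]`, every `[1_U ⊗ w]` is a `[1_{K₀} ⊗ w′]`
for a compact open `K₀ ≤ ker η`, and by ★ `exists_eq_sum_indicatorSection_conj` so is every class); §2 TWISTED CELLS — for `I = Ind_P^G τ′` with
`G = P ⊔ P w₀ N` and (Supp), the cell map twisted by `θ⁻¹` on both sides is still an injective `N`-map, so BZ left exactness ★
`coinvariantsMap_injective_of_isLimitOfCompactOpen` + §1 bound `(I_open ⊗ θ⁻¹)_N`, and when `N` acts trivially on `W` and `θ(n₀) ≠ 1` every class of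
`J_θ(I)` comes from `I_open` (`[I(n₀) f] = θ(n₀) [f]`, `(I(n₀) f − f)(1) = 0`); §3 the `normalizedInd` spelling; §4 `U(Φ₂)` over ★ `u2LocalBruhatDecomposition`,
★ (Supp)₂ `hasCompactSupport_cellFun_cmBorel_two`, ★ `isLimitOfCompactOpen_cmBorelTriple_N`.  The twistedSpan spelling of p01's census follows through ★
`R90S4TwistedSpanTransport.ker_charTwist_eq_twistedSpan` for any one-parameter `e` onto `N` with `θ(e x) = ψ(a x)`.

HONEST LABEL: HC_CM is proved only modulo the 7 printed citations (2 remaining named inputs: hLiu418 = stmt-HodgeConjecture-24832,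
h413 = stmt-HodgeConjecture-24833) until rung 0 closes; plumbing toward (SWAP), which stays OPEN until p01's assembly lands and B re-ties.  REL ≠ ★ ≠ BUILT.

## Mathlib ∕ tree search
Tree ★ reused by import (never restated): `compactlySupported`, `indicatorSection{,_eq_sum_transversal,_add,_smul,_mem_compactlySupported}`,
`exists_eq_sum_indicatorSection_conj`, `isOpen_conj_smul`, `isCompact_conj_smul`, `cellFunMap`, `cellFunMapRestrict`, `vanishingOnSubgroup`,
`eq_zero_of_cellFunMap_eq_zero`, `isSmooth_compactlySupported`, `exists_isLeftTransversal`, `Representation.charTwist`, `coinvariantsMk_charTwist_apply`,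
`IsSmooth.twist`, `coinvariantsMap_injective_of_isLimitOfCompactOpen`, `ParabolicTriple.proj_apply_of_mem_N`, `rootDeltaChar_eq_one_of_isLimitOfCompactOpen`.
Mathlib: `Representation.Coinvariants.{mk, map, mk_self_apply, map_mk}`, `twist_apply`, `Module.Finite.of_surjective ∕ of_injective`,
`LinearMap.finrank_le_finrank_of_surjective ∕ _of_injective`.  Dedup `rg "twist_compactlySupported|charTwist_smoothIndRep|charTwist_cmPrincipalSeries"`: none.

## References
* [Casselman1995] W. Casselman, *Introduction to the theory of admissible representations of p-adic reductive groups* (1995), §6.3, Lemma 7.1.1 (a) p. 67.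
* [BernsteinZelevinskyASENS1977] I. N. Bernstein, A. V. Zelevinsky, *Induced representations of reductive p-adic groups I*, Ann. Sci. ÉNS 10 (1977), §1.8 (b), Prop. 1.9 (a), Thm. 5.2.
* [BernsteinZelevinsky1976] —, *Representations of the group GL(n, F)…*, Russian Math. Surveys 31:3 (1976), §1.18–§1.19, §2.33.
* [Bump1997] D. Bump, *Automorphic Forms and Representations* (1997), §4.4 pp. 460–465.
* [Rogawski1990] J. D. Rogawski, *Automorphic Representations of Unitary Groups in Three Variables* (1990), §11.1 p. 161, §12.1 p. 171.
-/

set_option autoImplicit false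
-- the mandated namespace (brief §3.4) repeats the single-problem summit's segment (`HodgeConjecture.HodgeConjecture`)
set_option linter.dupNamespace false

noncomputable section

open scoped BigOperators Pointwise MatrixGroups
open NumberField IsDedekindDomain
open Literature.NumberTheory.Automorphic Literature.NumberTheory.Automorphic.UnitaryGroup

namespace Summit.HodgeConjecture.HodgeConjecture.R90.S4

open Representation

/-! ## §1 TWISTED G1: `dim (C_c^∞(N, W) ⊗ η)_N ≤ dim W` for a character `η` of the `l`-group `N` with open kernel -/

section TwistedG1

variable {k : Type*} [Field k] {N : Type*} [Group N] [TopologicalSpace N] [IsTopologicalGroup N]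
  {W : Type*} [AddCommGroup W] [Module k W] (η : N →* kˣ)

omit [TopologicalSpace N] [IsTopologicalGroup N] in
/-- **In the coinvariants of a twist `ρ ⊗ χ` the group acts on classes through `χ⁻¹`: `[ρ(g) v] = χ(g)⁻¹ • [v]`** (`[χ(g) ρ(g) v] = [v]`). [cite: BernsteinZelevinskyASENS1977, §1.8 (b)] -/
theorem mk_twist_apply_eq_inv_smul {G V : Type*} [Group G] [AddCommGroup V] [Module k V]
    (ρ : Representation k G V) (χ : G →* kˣ) (g : G) (v : V) :
    Coinvariants.mk (ρ.twist χ) (ρ g v) = ((χ g)⁻¹ : kˣ) • Coinvariants.mk (ρ.twist χ) v := by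
  have h := Coinvariants.mk_self_apply (ρ.twist χ) g v
  rw [twist_apply, map_smul, ← Units.smul_def] at h
  rw [← h, inv_smul_smul]

/-- **Twisted tiling**: for compact open subgroups `V ≤ U` and a left transversal `R` of `U ∕ V`, in the coinvariants of `C_c^∞(N, W) ⊗ η`,
`[1_U ⊗ w] = (Σ_{r ∈ R} η(r)⁻¹) • [1_V ⊗ w]` (★ `indicatorSection_eq_sum_transversal` + `[r · φ] = η(r)⁻¹ [φ]`). [cite: BernsteinZelevinsky1976, §1.18–§1.19] -/
theorem mk_twist_indicatorSection_eq_sum_smul {U V : Subgroup N} (hU : IsOpen (U : Set N)) (hUc : IsCompact (U : Set N))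
    (hV : IsOpen (V : Set N)) (hVc : IsCompact (V : Set N)) (hVU : V ≤ U) {R : Finset N} (hR : IsLeftTransversal U V R) (w : W) :
    Coinvariants.mk ((compactlySupported k N W).toRepresentation.twist η)
        ⟨indicatorSection U hU w, indicatorSection_mem_compactlySupported U hU hUc w⟩ =
      (∑ r ∈ R, (((η r)⁻¹ : kˣ) : k)) • Coinvariants.mk ((compactlySupported k N W).toRepresentation.twist η)
        ⟨indicatorSection V hV w, indicatorSection_mem_compactlySupported V hV hVc w⟩ := by
  have hsum : (⟨indicatorSection U hU w, indicatorSection_mem_compactlySupported U hU hUc w⟩ : ↥(compactlySupported k N W).toSubmodule) =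
      ∑ r ∈ R, (compactlySupported k N W).toRepresentation r ⟨indicatorSection V hV w, indicatorSection_mem_compactlySupported V hV hVc w⟩ :=
    Subtype.ext (by rw [Submodule.coe_sum]; exact indicatorSection_eq_sum_transversal hU hV hVU hR w)
  rw [hsum, map_sum, Finset.sum_smul]
  exact Finset.sum_congr rfl fun r _ => by rw [mk_twist_apply_eq_inv_smul, Units.smul_def]

/-- **Tiling inside `ker η`**: if moreover `U ≤ ker η` then `[1_U ⊗ w] = |R| • [1_V ⊗ w]` (every `η(r) = 1`). [cite: BernsteinZelevinsky1976, §1.18–§1.19] -/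
theorem mk_twist_indicatorSection_eq_card_smul {U V : Subgroup N} (hU : IsOpen (U : Set N)) (hUc : IsCompact (U : Set N))
    (hV : IsOpen (V : Set N)) (hVc : IsCompact (V : Set N)) (hVU : V ≤ U) (hUη : U ≤ η.ker) {R : Finset N} (hR : IsLeftTransversal U V R) (w : W) :
    Coinvariants.mk ((compactlySupported k N W).toRepresentation.twist η)
        ⟨indicatorSection U hU w, indicatorSection_mem_compactlySupported U hU hUc w⟩ =
      (R.card : k) • Coinvariants.mk ((compactlySupported k N W).toRepresentation.twist η)
        ⟨indicatorSection V hV w, indicatorSection_mem_compactlySupported V hV hVc w⟩ := by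
  have h1 : ∀ r ∈ R, (((η r)⁻¹ : kˣ) : k) = 1 := fun r hr => by
    rw [(MonoidHom.mem_ker).1 (hUη (hR.mem_of_mem r hr)), inv_one, Units.val_one]
  rw [mk_twist_indicatorSection_eq_sum_smul η hU hUc hV hVc hVU hR w, Finset.sum_congr rfl h1, Finset.sum_const, nsmul_eq_mul, mul_one]

variable [CharZero k]

/-- **Every `[1_U ⊗ w]` is a `[1_{K₀} ⊗ w′]` for a compact open `K₀ ≤ ker η`** (`U` compact open): with `V := U ∩ K₀`, `[1_U ⊗ w] = c₁ • [1_V ⊗ w]`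
(`c₁ = Σ_{R₁} η(r)⁻¹`) and `[1_{K₀} ⊗ w] = |R₂| • [1_V ⊗ w]`, so `w′ = (c₁ |R₂|⁻¹) w` (char. `0`). [cite: BernsteinZelevinsky1976, §1.18–§1.19] -/
theorem exists_mk_twist_indicatorSection_eq (K₀ : Subgroup N) (hK₀ : IsOpen (K₀ : Set N)) (hK₀c : IsCompact (K₀ : Set N))
    (hK₀η : K₀ ≤ η.ker) (U : Subgroup N) (hU : IsOpen (U : Set N)) (hUc : IsCompact (U : Set N)) (w : W) :
    ∃ w' : W, Coinvariants.mk ((compactlySupported k N W).toRepresentation.twist η)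
        ⟨indicatorSection U hU w, indicatorSection_mem_compactlySupported U hU hUc w⟩ =
      Coinvariants.mk ((compactlySupported k N W).toRepresentation.twist η)
        ⟨indicatorSection K₀ hK₀ w', indicatorSection_mem_compactlySupported K₀ hK₀ hK₀c w'⟩ := by
  have hVo : IsOpen ((U ⊓ K₀ : Subgroup N) : Set N) := hU.inter hK₀
  have hVc : IsCompact ((U ⊓ K₀ : Subgroup N) : Set N) := hUc.of_isClosed_subset (Subgroup.isClosed_of_isOpen _ hVo) fun x hx => hx.1
  obtain ⟨R₁, hR₁⟩ := exists_isLeftTransversal (B := U) (T := K₀) hUc hK₀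
  obtain ⟨R₂, hR₂⟩ := exists_isLeftTransversal (B := K₀) (T := U) hK₀c hU
  rw [show K₀ ⊓ U = U ⊓ K₀ from inf_comm _ _] at hR₂
  have h1 := mk_twist_indicatorSection_eq_sum_smul η hU hUc hVo hVc inf_le_left hR₁ w
  have h2 := mk_twist_indicatorSection_eq_card_smul η hK₀ hK₀c hVo hVc inf_le_right hK₀η hR₂ w
  have hR₂0 : (R₂.card : k) ≠ 0 := Nat.cast_ne_zero.2 (Finset.card_pos.2 hR₂.nonempty).ne'
  refine ⟨((∑ r ∈ R₁, (((η r)⁻¹ : kˣ) : k)) * (R₂.card : k)⁻¹) • w, ?_⟩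
  have hlin : (⟨indicatorSection K₀ hK₀ (((∑ r ∈ R₁, (((η r)⁻¹ : kˣ) : k)) * (R₂.card : k)⁻¹) • w),
      indicatorSection_mem_compactlySupported K₀ hK₀ hK₀c _⟩ : ↥(compactlySupported k N W).toSubmodule) =
      ((∑ r ∈ R₁, (((η r)⁻¹ : kˣ) : k)) * (R₂.card : k)⁻¹) •
        ⟨indicatorSection K₀ hK₀ w, indicatorSection_mem_compactlySupported K₀ hK₀ hK₀c w⟩ :=
    Subtype.ext (indicatorSection_smul K₀ hK₀ _ w)
  rw [hlin, map_smul, h2, h1, smul_smul, mul_assoc, inv_mul_cancel₀ hR₂0, mul_one]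

/-- **Every class of `(C_c^∞(N, W) ⊗ η)_N` is an indicator class `[1_{K₀} ⊗ w]`** (`K₀ ≤ ker η` compact open): decompose `φ = Σ_q q̃⁻¹ · (1_{q̃ S q̃⁻¹} ⊗ φ(q̃))`
(★ `exists_eq_sum_indicatorSection_conj`), move each `q̃⁻¹` out as the scalar `η(q̃⁻¹)⁻¹`, and use the previous lemma termwise. [cite: BernsteinZelevinskyASENS1977, Prop. 1.9 (a)] -/
theorem exists_eq_mk_twist_indicatorSection (K₀ : Subgroup N) (hK₀ : IsOpen (K₀ : Set N)) (hK₀c : IsCompact (K₀ : Set N))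
    (hK₀η : K₀ ≤ η.ker) (x : ((compactlySupported k N W).toRepresentation.twist η).Coinvariants) :
    ∃ w : W, x = Coinvariants.mk ((compactlySupported k N W).toRepresentation.twist η)
      ⟨indicatorSection K₀ hK₀ w, indicatorSection_mem_compactlySupported K₀ hK₀ hK₀c w⟩ := by
  -- the indicator classes form a submodule
  let Sm : Submodule k ((compactlySupported k N W).toRepresentation.twist η).Coinvariants :=
    { carrier := {x | ∃ w : W, x = Coinvariants.mk ((compactlySupported k N W).toRepresentation.twist η)
        ⟨indicatorSection K₀ hK₀ w, indicatorSection_mem_compactlySupported K₀ hK₀ hK₀c w⟩}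
      add_mem' := by
        rintro _ _ ⟨w, rfl⟩ ⟨w', rfl⟩
        exact ⟨w + w', by rw [← map_add]; exact congrArg _ (Subtype.ext (indicatorSection_add K₀ hK₀ w w').symm)⟩
      zero_mem' := ⟨0, by
        have h := indicatorSection_smul (k := k) K₀ hK₀ (0 : k) (0 : W)
        rw [zero_smul, zero_smul] at h
        rw [show (⟨indicatorSection K₀ hK₀ (0 : W), indicatorSection_mem_compactlySupported K₀ hK₀ hK₀c (0 : W)⟩ :
            ↥(compactlySupported k N W).toSubmodule) = 0 from Subtype.ext h, map_zero]⟩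
      smul_mem' := by
        rintro c _ ⟨w, rfl⟩
        exact ⟨c • w, by rw [← map_smul]; exact congrArg _ (Subtype.ext (indicatorSection_smul K₀ hK₀ c w).symm)⟩ }
  change x ∈ Sm
  obtain ⟨⟨φ, hφ⟩, rfl⟩ := Coinvariants.mk_surjective _ x
  obtain ⟨S, hSo, hSc, T, hφT⟩ := exists_eq_sum_indicatorSection_conj (k := k) K₀ hK₀ hK₀c φ hφ
  have hsum : (⟨φ, hφ⟩ : ↥(compactlySupported k N W).toSubmodule) =
      ∑ q ∈ T, (compactlySupported k N W).toRepresentation (q.out)⁻¹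
        ⟨indicatorSection (MulAut.conj q.out • S) (isOpen_conj_smul S hSo q.out) (φ.toFun q.out),
          indicatorSection_mem_compactlySupported _ _ (isCompact_conj_smul S hSc q.out) _⟩ :=
    Subtype.ext (by rw [Submodule.coe_sum]; exact hφT)
  rw [hsum, map_sum]
  refine Sm.sum_mem fun q _ => ?_
  rw [mk_twist_apply_eq_inv_smul, Units.smul_def]
  exact Sm.smul_mem _ (exists_mk_twist_indicatorSection_eq η K₀ hK₀ hK₀c hK₀η (MulAut.conj q.out • S)
    (isOpen_conj_smul S hSo q.out) (isCompact_conj_smul S hSc q.out) (φ.toFun q.out))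

/-- **TWISTED G1: `dim (C_c^∞(N, W) ⊗ η)_N ≤ dim W`.**  For a topological group `N` which is the union of its compact open subgroups (★
`IsLimitOfCompactOpen`), a character `η : N →* kˣ` with OPEN kernel and `W` finite-dimensional over a field of characteristic `0`, the coinvariants of the
twist `C_c^∞(N, W) ⊗ η` of the right regular representation are a quotient of `W` (`w ↦ [1_{K₀} ⊗ w]`, `K₀ ≤ ker η` compact open), hence of dimension
`≤ dim W` (measure-free twin of ★ `finrank_coinvariants_compactlySupported_le`; with a Haar measure, `φ ↦ ∫_N φ η⁻¹` is an isomorphism).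
[cite: BernsteinZelevinskyASENS1977, Prop. 1.9 (a), Thm. 5.2] [cite: Bump1997, §4.4 pp. 460–462] -/
theorem finrank_coinvariants_twist_compactlySupported_le [FiniteDimensional k W] (hN : IsLimitOfCompactOpen N)
    (hη : IsOpen ((η.ker : Subgroup N) : Set N)) :
    Module.Finite k ((compactlySupported k N W).toRepresentation.twist η).Coinvariants ∧
      Module.finrank k ((compactlySupported k N W).toRepresentation.twist η).Coinvariants ≤ Module.finrank k W := by
  -- a compact open subgroup inside `ker η`
  obtain ⟨K, hKo, hKc, -⟩ := hN {1} isCompact_singleton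
  have hK₀o : IsOpen ((K ⊓ η.ker : Subgroup N) : Set N) := hKo.inter hη
  have hK₀c : IsCompact ((K ⊓ η.ker : Subgroup N) : Set N) := hKc.of_isClosed_subset (Subgroup.isClosed_of_isOpen _ hK₀o) fun x hx => hx.1
  let f : W →ₗ[k] ((compactlySupported k N W).toRepresentation.twist η).Coinvariants :=
    { toFun := fun w => Coinvariants.mk ((compactlySupported k N W).toRepresentation.twist η)
        ⟨indicatorSection (K ⊓ η.ker) hK₀o w, indicatorSection_mem_compactlySupported _ hK₀o hK₀c w⟩
      map_add' := fun w w' => by rw [← map_add]; exact congrArg _ (Subtype.ext (indicatorSection_add _ hK₀o w w'))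
      map_smul' := fun c w => by rw [RingHom.id_apply, ← map_smul]; exact congrArg _ (Subtype.ext (indicatorSection_smul _ hK₀o c w)) }
  have hsurj : Function.Surjective f := fun x => by
    obtain ⟨w, hw⟩ := exists_eq_mk_twist_indicatorSection η (K ⊓ η.ker) hK₀o hK₀c inf_le_right x
    exact ⟨w, hw.symm⟩
  exact ⟨Module.Finite.of_surjective f hsurj, LinearMap.finrank_le_finrank_of_surjective hsurj⟩

end TwistedG1

/-! ## §2 TWISTED CELLS: `dim J_θ(Ind_P^G τ′) ≤ dim W` under `G = P ⊔ P w₀ N`, (Supp), `N` acting trivially on `W`, `θ ≠ 1` -/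

section TwistedCell

variable {k : Type*} [Field k] [CharZero k] {G : Type*} [Group G] [TopologicalSpace G] [IsTopologicalGroup G]
  (P : Subgroup G) {W : Type*} [AddCommGroup W] [Module k W] (τ' : Representation k P W)
  (N : Subgroup G) (hNP : N ≤ P) (w₀ : G)
  (hsupp : ∀ f : SmoothInd P τ', f ∈ vanishingOnSubgroup (k := k) P τ' N hNP →
    cellFunMap (k := k) P τ' N w₀ f ∈ compactlySupported k ↥N W)
  (θ : ↥N →* kˣ)

include hsupp in
omit [CharZero k] in
/-- **The cell-function map `I_open → C_c^∞(N, W)` is injective under `G = P ⊔ P w₀ N`** (★ `eq_zero_of_cellFunMap_eq_zero`; the ★ open-cell file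
proves this inline). [cite: BernsteinZelevinskyASENS1977, Thm. 5.2] [cite: Casselman1995, §6.3] -/
theorem cellFunMapRestrict_injective (hBruhat : ∀ g : G, g ∈ P ∨ ∃ p ∈ P, ∃ n ∈ N, g = p * w₀ * n) :
    Function.Injective (cellFunMapRestrict (k := k) P τ' N hNP w₀ hsupp) := by
  intro f g hfg
  have h := congrArg (fun x : ↥(compactlySupported k ↥N W).toSubmodule =>
    (x : SmoothInd (⊥ : Subgroup ↥N) (Representation.trivial k (⊥ : Subgroup ↥N) W))) hfg
  simp only [coe_cellFunMapRestrict_apply] at h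
  have hsub : f.1 - g.1 = 0 := by
    refine eq_zero_of_cellFunMap_eq_zero (k := k) P τ' N hNP w₀ hBruhat
      ((vanishingOnSubgroup (k := k) P τ' N hNP).toSubmodule.sub_mem f.2 g.2) ?_
    rw [map_sub, h, sub_self]
  exact Subtype.ext (sub_eq_zero.1 hsub)

include hsupp in
/-- **`dim (I_open ⊗ θ⁻¹)_N ≤ dim W`**: the cell map twisted on both sides by `θ⁻¹` is still an injective `N`-map into the SMOOTH `C_c^∞(N, W) ⊗ θ⁻¹`
(★ `isSmooth_compactlySupported`, ★ `IsSmooth.twist`), hence injective on coinvariants (BZ ★ `coinvariantsMap_injective_of_isLimitOfCompactOpen`); §1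
bounds the target. [cite: BernsteinZelevinskyASENS1977, Prop. 1.9 (a), Thm. 5.2] [cite: Casselman1995, Lemma 7.1.1 (a)] -/
theorem finrank_coinvariants_twist_vanishingOnSubgroup_le [FiniteDimensional k W] (hN : IsLimitOfCompactOpen ↥N)
    (hBruhat : ∀ g : G, g ∈ P ∨ ∃ p ∈ P, ∃ n ∈ N, g = p * w₀ * n) (hθ : IsOpen ((θ.ker : Subgroup ↥N) : Set ↥N)) :
    Module.Finite k ((vanishingOnSubgroup (k := k) P τ' N hNP).toRepresentation.twist θ⁻¹).Coinvariants ∧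
      Module.finrank k ((vanishingOnSubgroup (k := k) P τ' N hNP).toRepresentation.twist θ⁻¹).Coinvariants ≤
        Module.finrank k W := by
  -- the twisted cell map (same linear map as ★ `cellFunMapRestrict`)
  let c : ((vanishingOnSubgroup (k := k) P τ' N hNP).toRepresentation.twist θ⁻¹).IntertwiningMap
      ((compactlySupported k ↥N W).toRepresentation.twist θ⁻¹) :=
    { toLinearMap := (cellFunMapRestrict (k := k) P τ' N hNP w₀ hsupp).toLinearMap
      isIntertwining' := fun n => by
        have h := (cellFunMapRestrict (k := k) P τ' N hNP w₀ hsupp).isIntertwining' n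
        change (cellFunMapRestrict (k := k) P τ' N hNP w₀ hsupp).toLinearMap ∘ₗ
            ((((θ⁻¹ n : kˣ) : k)) • (vanishingOnSubgroup (k := k) P τ' N hNP).toRepresentation n) =
          ((((θ⁻¹ n : kˣ) : k)) • (compactlySupported k ↥N W).toRepresentation n) ∘ₗ
            (cellFunMapRestrict (k := k) P τ' N hNP w₀ hsupp).toLinearMap
        rw [LinearMap.comp_smul, LinearMap.smul_comp, h] }
  have hinj : Function.Injective c := fun f g hfg =>
    cellFunMapRestrict_injective P τ' N hNP w₀ hsupp hBruhat hfg
  have hker' : IsOpen (((θ⁻¹ : ↥N →* kˣ).ker : Subgroup ↥N) : Set ↥N) := by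
    have hEq : (((θ⁻¹ : ↥N →* kˣ).ker : Subgroup ↥N) : Set ↥N) = θ.ker :=
      Set.ext fun n => by simp only [SetLike.mem_coe, MonoidHom.mem_ker, MonoidHom.inv_apply, inv_eq_one]
    exact hEq ▸ hθ
  have hsm : ((compactlySupported k ↥N W).toRepresentation.twist θ⁻¹).IsSmooth :=
    (isSmooth_compactlySupported (k := k) (W := W) ↥N).twist hker'
  have hmapinj := coinvariantsMap_injective_of_isLimitOfCompactOpen hN hsm c hinj
  obtain ⟨hfd, hle⟩ := finrank_coinvariants_twist_compactlySupported_le (W := W) (θ⁻¹ : ↥N →* kˣ) hN hker'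
  haveI := hfd
  exact ⟨Module.Finite.of_injective _ hmapinj, (LinearMap.finrank_le_finrank_of_injective hmapinj).trans hle⟩

include hsupp in
/-- **TWISTED CELLS: `dim J_θ(Ind_P^G τ′) ≤ dim W`.**  Let `I = Ind_P^G τ′` with `G = P ⊔ P w₀ N` (two cells), compactly supported cell functions on
`I_open` (Supp), `N ≤ P` the union of its compact open subgroups acting TRIVIALLY on `W` through `τ′`, and `θ : N →* kˣ` NON-TRIVIAL with open kernel.
Then `J_θ(I) = I ⁄ I(N, θ)` (Mathlib `Coinvariants` of ★ `I.charTwist N θ`) is finite-dimensional with `finrank ≤ finrank W`.  OPEN CELL: the previous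
lemma.  CLOSED CELL: for `f ∈ I`, `g := I(n₀) f − f` has `g(1) = τ′(n₀) f(1) − f(1) = 0`, i.e. `g ∈ I_open`, while `[g] = (θ(n₀) − 1) [f]` (★
`coinvariantsMk_charTwist_apply`), so `[f]` comes from `J_θ(I_open)`. [cite: Casselman1995, §6.3, Lemma 7.1.1 (a)] [cite: BernsteinZelevinskyASENS1977, Thm. 5.2]
[cite: Bump1997, §4.4 pp. 462–465] -/
theorem finrank_coinvariants_charTwist_smoothIndRep_le [FiniteDimensional k W] (hN : IsLimitOfCompactOpen ↥N)
    (hBruhat : ∀ g : G, g ∈ P ∨ ∃ p ∈ P, ∃ n ∈ N, g = p * w₀ * n) (hθ : IsOpen ((θ.ker : Subgroup ↥N) : Set ↥N))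
    (hθ1 : ∃ n : ↥N, θ n ≠ 1) (hNW : ∀ n : ↥N, τ' ⟨(n : G), hNP n.2⟩ = 1) :
    Module.Finite k ((smoothIndRep P τ').charTwist N θ).Coinvariants ∧
      Module.finrank k ((smoothIndRep P τ').charTwist N θ).Coinvariants ≤ Module.finrank k W := by
  obtain ⟨hfd, hle⟩ := finrank_coinvariants_twist_vanishingOnSubgroup_le P τ' N hNP w₀ hsupp θ hN hBruhat hθ
  haveI := hfd
  -- the inclusion `I_open ⊗ θ⁻¹ ↪ I|_N ⊗ θ⁻¹`
  let ι : ((vanishingOnSubgroup (k := k) P τ' N hNP).toRepresentation.twist θ⁻¹).IntertwiningMap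
      ((smoothIndRep P τ').charTwist N θ) :=
    { toLinearMap := (vanishingOnSubgroup (k := k) P τ' N hNP).toSubmodule.subtype
      isIntertwining' := fun n => LinearMap.ext fun f => rfl }
  -- CLOSED CELL: every class of `J_θ(I)` is the class of a function vanishing at `1`
  have hsurj : Function.Surjective (Coinvariants.map _ _ ι) := by
    obtain ⟨n₀, hn₀⟩ := hθ1
    intro x
    obtain ⟨f, rfl⟩ := Coinvariants.mk_surjective _ x
    -- `f(n₀) = τ′(n₀) f(1) = f(1)`
    have h2 : f.toFun (n₀ : G) = f.toFun 1 := by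
      have h := SmoothInd.toFun_subgroup_mul f ⟨(n₀ : G), hNP n₀.2⟩ 1
      rw [hNW n₀, mul_one] at h
      exact h
    have hg : smoothIndRep P τ' (n₀ : G) f - f ∈ vanishingOnSubgroup (k := k) P τ' N hNP := by
      rw [mem_vanishingOnSubgroup_iff_toFun_one]
      change (smoothIndRep P τ' (n₀ : G) f).toFun 1 - f.toFun 1 = 0
      rw [toFun_smoothIndRep_apply, one_mul, h2, sub_self]
    have hc : (((θ n₀ : kˣ) : k)) - 1 ≠ 0 := sub_ne_zero.2 fun h => hn₀ (Units.val_eq_one.1 h)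
    refine ⟨((((θ n₀ : kˣ) : k)) - 1)⁻¹ • Coinvariants.mk _ ⟨_, hg⟩, ?_⟩
    rw [map_smul, Coinvariants.map_mk]
    change ((((θ n₀ : kˣ) : k)) - 1)⁻¹ •
        Coinvariants.mk ((smoothIndRep P τ').charTwist N θ) (smoothIndRep P τ' (n₀ : G) f - f) =
      Coinvariants.mk ((smoothIndRep P τ').charTwist N θ) f
    have hcl : Coinvariants.mk ((smoothIndRep P τ').charTwist N θ) (smoothIndRep P τ' (n₀ : G) f - f) =
        ((((θ n₀ : kˣ) : k)) - 1) • Coinvariants.mk ((smoothIndRep P τ').charTwist N θ) f := by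
      rw [map_sub, coinvariantsMk_charTwist_apply, Units.smul_def, sub_smul, one_smul]
    rw [hcl, smul_smul, inv_mul_cancel₀ hc, one_smul]
  exact ⟨Module.Finite.of_surjective _ hsurj, (LinearMap.finrank_le_finrank_of_surjective hsurj).trans hle⟩

end TwistedCell

/-! ## §3 The `normalizedInd` spelling: `dim J_θ(i_P^G σ) ≤ dim W` -/

section NormalizedInd

variable {G : Type*} [Group G] [TopologicalSpace G] [IsTopologicalGroup G] (t : ParabolicTriple G)
  {W : Type*} [AddCommGroup W] [Module ℂ W]

/-- **`N` acts trivially on `σ ∘ proj ⊗ δ_P^{1∕2}`** (the inducing datum of ★ `normalizedInd`): `proj` kills `N` (★ `proj_apply_of_mem_N`) and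
`δ_P^{1∕2}(n) = 1` (★ `rootDeltaChar_eq_one_of_isLimitOfCompactOpen`). [cite: BernsteinZelevinskyASENS1977, §1.8] [cite: Casselman1995, §6.3] -/
theorem twist_comp_proj_rootDeltaChar_apply_eq_one [LocallyCompactSpace ↥t.P] (σ : Representation ℂ t.M W)
    (hN : IsLimitOfCompactOpen ↥t.N) (n : ↥t.N) :
    Representation.twist (σ.comp t.proj) (rootDeltaChar t.P) ⟨(n : G), t.N_le n.2⟩ = 1 := by
  refine LinearMap.ext fun w => ?_
  rw [twist_apply, t.rootDeltaChar_eq_one_of_isLimitOfCompactOpen hN (n : G) n.2, Units.val_one, one_smul,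
    MonoidHom.comp_apply, t.proj_apply_of_mem_N ⟨(n : G), t.N_le n.2⟩ n.2, map_one]

/-- **`dim J_θ(i_P^G σ) ≤ dim W` for NORMALISED induction** `i_P^G σ = Ind_P^G (σ ∘ proj ⊗ δ_P^{1∕2})` (★ `normalizedInd`) from a parabolic triple
`t = (P, M, N)` with `G = P ⊔ P w₀ N`, compactly supported cell functions, `N` the union of its compact open subgroups, and a NON-TRIVIAL `θ : N →* ℂˣ`
with open kernel (§2 with the trivial `N`-action of §3's first lemma). [cite: Casselman1995, §6.3, Lemma 7.1.1 (a)] [cite: BernsteinZelevinskyASENS1977, Thm. 5.2] -/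
theorem finrank_coinvariants_charTwist_normalizedInd_le [LocallyCompactSpace ↥t.P] [FiniteDimensional ℂ W]
    (σ : Representation ℂ t.M W) (w₀ : G) (hN : IsLimitOfCompactOpen ↥t.N)
    (hBruhat : ∀ g : G, g ∈ t.P ∨ ∃ p ∈ t.P, ∃ n ∈ t.N, g = p * w₀ * n)
    (hsupp : ∀ f : SmoothInd t.P (Representation.twist (σ.comp t.proj) (rootDeltaChar t.P)),
      f.toFun 1 = 0 → HasCompactSupport fun n : ↥t.N => f.toFun (w₀ * (n : G)))
    (θ : ↥t.N →* ℂˣ) (hθ : IsOpen ((θ.ker : Subgroup ↥t.N) : Set ↥t.N)) (hθ1 : θ ≠ 1) :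
    Module.Finite ℂ ((Representation.normalizedInd t σ).charTwist t.N θ).Coinvariants ∧
      Module.finrank ℂ ((Representation.normalizedInd t σ).charTwist t.N θ).Coinvariants ≤ Module.finrank ℂ W := by
  -- (Supp) in the `vanishingOnSubgroup` ∕ `compactlySupported` spelling (as in ★ `finrank_le_of_forall_mem_iff_exists_toFun_one_eq_zero`)
  have hsupp' : ∀ f : SmoothInd t.P (Representation.twist (σ.comp t.proj) (rootDeltaChar t.P)),
      f ∈ vanishingOnSubgroup (k := ℂ) t.P _ t.N t.N_le →
      cellFunMap (k := ℂ) t.P _ t.N w₀ f ∈ compactlySupported ℂ ↥t.N W := fun f hf => by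
    have h := hsupp f ((mem_vanishingOnSubgroup_iff_toFun_one t.P _ t.N t.N_le f).1 hf)
    exact ⟨tsupport fun n : ↥t.N => f.toFun (w₀ * (n : G)), h.isCompact, fun n hn => by
      rw [toFun_cellFunMap]; exact image_eq_zero_of_notMem_tsupport (f := fun m : ↥t.N => f.toFun (w₀ * (m : G))) hn⟩
  have hθ1' : ∃ n : ↥t.N, θ n ≠ 1 := by by_contra h; push Not at h; exact hθ1 (MonoidHom.ext h)
  exact finrank_coinvariants_charTwist_smoothIndRep_le t.P _ t.N t.N_le w₀ hsupp' θ hN hBruhat hθ hθ1'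
    (twist_comp_proj_rootDeltaChar_apply_eq_one t σ hN)

end NormalizedInd

/-! ## §4 `U(Φ₂)(L⁺_v)` at a non-split place: `dim i(χ)_{N,θ} ≤ 1` -/

section CM

variable (L : Type) [Field L] [NumberField L] [IsCMField L]

set_option maxHeartbeats 800000 in  -- MEASURED: default 200000 times out at `whnf` on the `rfl`-bridge `cmPrincipalSeries L 2 v χ = normalizedInd (cmBorelTriple L 2 v) (𝟙 ⊗ χ)` (statement elaboration); 400000 passes with the STEPWISE `have`s below (one-shot forms time out); 800000 for margin; no `synthInstance` raise needed
/-- **`dim i(χ)_{N,θ} ≤ 1` FOR `U(Φ₂)(L⁺_v) ≅ U(1,1)` AT A NON-SPLIT PLACE.**  For every character `χ` of the diagonal torus `T(L⁺_v)` and every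
NON-TRIVIAL character `θ` of the unipotent radical `N(L⁺_v)` of the CM Borel `B = TN` (★ `cmBorelTriple L 2 v`) with open kernel, the `θ`-twisted
coinvariants `J_θ(i(χ)) = i(χ) ⁄ i(χ)(N, θ)` of the principal series `i(χ) = cmPrincipalSeries L 2 v χ` are finite-dimensional of dimension `≤ 1`:
the two hypotheses `[Module.Finite ℂ (ρ.charTwist H θ).Coinvariants]`, `finrank ≤ 1` of the slot lemma ★
`R90S4TwistedCoinvariantSlot.not_nontrivial_coinvariants_charTwist_of_ne` at `ρ = i(χ)`, `H = N` — «for each `ψ ≠ 1` at most one of the two constituents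
`π⁺, π⁻` of `i(χ)` is `ψ`-generic».  Inputs: `U(Φ₂) = B ⊔ B w₀ N` (★ `u2LocalBruhatDecomposition`), (Supp)₂ (★ `hasCompactSupport_cellFun_cmBorel_two`),
★ `isLimitOfCompactOpen_cmBorelTriple_N`, §3 at `W = ℂ`. [cite: Casselman1995, §6.3, Lemma 7.1.1 (a) p. 67] [cite: BernsteinZelevinskyASENS1977, Thm. 5.2]
[cite: Bump1997, §4.4 pp. 462–465] [cite: Rogawski1990, §11.1 p. 161; §12.1 p. 171] -/
theorem finrank_coinvariants_charTwist_cmPrincipalSeries_two_le_one (v : HeightOneSpectrum (𝓞 ↥(maximalRealSubfield L)))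
    (hns : ∀ w : PlacesOver L v, IsCMField.complexConj L • w.1 = w.1)
    (χ : ↥(torusU (conjLocal L (IsCMField.complexConj L) v) (cmLocalForm L 2 v)) →* ℂˣ)
    (θ : ↥(cmBorelTriple L 2 v).N →* ℂˣ) (hθ : IsOpen ((θ.ker : Subgroup ↥(cmBorelTriple L 2 v).N) : Set ↥(cmBorelTriple L 2 v).N))
    (hθ1 : θ ≠ 1) :
    Module.Finite ℂ ((cmPrincipalSeries L 2 v χ).charTwist (cmBorelTriple L 2 v).N θ).Coinvariants ∧
      Module.finrank ℂ ((cmPrincipalSeries L 2 v χ).charTwist (cmBorelTriple L 2 v).N θ).Coinvariants ≤ 1 := by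
  haveI := locallyCompactSpace_cmBorelU L 2 v
  -- Bruhat (stepwise, as in ★ `finiteDimensional_finrank_coinvariants_cmPrincipalSeries_two_le_two`)
  have H0 := u2LocalBruhatDecomposition L v
  have H1 := H0 hns
  obtain ⟨w₀, hval, -, hBruhat, -⟩ := H1
  have hB : ∀ g : ↥(unitaryGroupOfForm (conjLocal L (IsCMField.complexConj L) v) (cmLocalForm L 2 v)),
      g ∈ (cmBorelTriple L 2 v).P ∨ ∃ p ∈ (cmBorelTriple L 2 v).P, ∃ n ∈ (cmBorelTriple L 2 v).N, g = p * w₀ * n := hBruhat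
  -- (Supp)₂
  have hS : ∀ f : Representation.SmoothInd (cmBorelTriple L 2 v).P
      (Representation.twist
        ((((Representation.trivial ℂ ↥(torusU (conjLocal L (IsCMField.complexConj L) v) (cmLocalForm L 2 v)) ℂ).twist
          χ)).comp (cmBorelTriple L 2 v).proj) (rootDeltaChar (cmBorelTriple L 2 v).P)),
      f.toFun 1 = 0 → HasCompactSupport fun n : ↥(cmBorelTriple L 2 v).N =>
        f.toFun (w₀ * (n : ↥(unitaryGroupOfForm (conjLocal L (IsCMField.complexConj L) v) (cmLocalForm L 2 v)))) :=
    fun f hf => Summit.HodgeConjecture.HodgeConjecture.Cruxes.H413.F0P3bU2PrincipalSeriesJacquetRankLeTwo.hasCompactSupport_cellFun_cmBorel_two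
      L v hns w₀ hval _ f hf
  have hN := isLimitOfCompactOpen_cmBorelTriple_N L 2 v
  have H := finrank_coinvariants_charTwist_normalizedInd_le (cmBorelTriple L 2 v)
    ((Representation.trivial ℂ ↥(torusU (conjLocal L (IsCMField.complexConj L) v) (cmLocalForm L 2 v)) ℂ).twist χ) w₀ hN hB hS θ hθ hθ1
  obtain ⟨hfd, hle⟩ := H
  have h1 : Module.finrank ℂ ℂ = 1 := Module.finrank_self ℂ
  refine ⟨hfd, ?_⟩
  change Module.finrank ℂ ((Representation.normalizedInd (cmBorelTriple L 2 v)
    ((Representation.trivial ℂ ↥(torusU (conjLocal L (IsCMField.complexConj L) v) (cmLocalForm L 2 v)) ℂ).twist χ)).charTwist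
      (cmBorelTriple L 2 v).N θ).Coinvariants ≤ 1
  omega

end CM

end Summit.HodgeConjecture.HodgeConjecture.R90.S4

end
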